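import Summits.QuantumFields.BalabanUV.InfraRed.StrongCouplingFrozenForestSpec

/-!
# Strong coupling, forest gauge — DLR equations and Dobrushin's condition for the frozen Wilson measure (rung F3, part 2 of 3)

**observatory of the non-perturbative crossover; no mass-gap claim.**  Cell `pub-balaban`, build IR-3 v2
(two-front crossover ledger), IR-SC lineage.  Part 2 of the proof of rung F3 `FrozenForestClustering` of
`StrongCouplingForestDoorAssembly` (part 1 `StrongCouplingFrozenForestSpec`: the frozen specification `frozenSpec F v`;
part 3 `StrongCouplingFrozenForestClustering`: the theorem).  This module, for `SU(N)` where stated: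
* §4 `frozenWilsonMeasure_eq_tilted`, `isGibbsMeasure_frozenWilsonMeasure` — the DLR equations of `μ_β^F` for the
  frozen specification;
* §5 `isKRContraction_frozenWilson` — Dobrushin's condition in Föllmer's Kantorovich–Rubinstein form (Ch. I (2.20))
  for the frozen specification with coefficients `C(e,y) = K (|β|/N) n(e,y)` between dynamic links and `0` as soon as
  `e` or `y` is frozen (the torus contraction `isKRContraction_torusWilson` read at frozen boundary conditions); the row
  sums are EXACTLY `K (|β|/N) · forestRow F e` (`sum_linkNbrT_frozenCoeff_eq`), `≤ D (|β|/N) K` under `ForestRowBound F D`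
  (`sum_linkNbrT_frozenCoeff_le`) — the forest-reduced Dobrushin constant;
* §6 DLR smoothing by the frozen specification (any compact group): locality (`dependsOn_specAvg_frozenSpec`) and the
  one-link Lipschitz bound (`isLipBound_specAvg_frozenSpec`, Georgii Prop. 8.8 in metric form, same constant as on the
  torus: a frozen outside link does not move the energy at all).

Every statement is kernel-checked; every analytic input (`OneLinkKRModulus`) is a HYPOTHESIS; nothing here moves any
number of the ledger (owned number unchanged, `β_W < 2/9`); no statement of the manuscripts under audit is used.
References: [cite: Follmer1988, Ch. I (2.20)] [cite: Georgii2011, Def. 2.9] [cite: Georgii2011, Prop. 8.8]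
[cite: FriedliVelenik2017, §6.10.1 eq. (6.110) with Lemma 6.15].
-/

noncomputable section

open MeasureTheory ProbabilityTheory Filter Function Finset
open Literature.Probability.LatticeModels
open Literature.Probability.LatticeModels.DobrushinMetric
open Literature.MathematicalPhysics.QuantumFieldTheory
open Literature.MathematicalPhysics.QuantumLattice (groupHeatKernelWeight fundamentalRep fundamentalRep_apply fundamentalLatticeRep
  toTorusObservable LGConfig IsLocalObservable torusEdge torusLift)
open Literature.MathematicalPhysics.QuantumFieldTheory.Balaban1983to89
open Literature.MathematicalPhysics.QuantumFieldTheory.Balaban1983to89.StrongCouplingDobrushinWindow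
open Literature.MathematicalPhysics.QuantumFieldTheory.Balaban1983to89.StrongCouplingTorusWindow
open Summit.QuantumFields.BalabanUV.InfraRed.StrongCouplingForestGauge
open Summit.QuantumFields.BalabanUV.InfraRed.StrongCouplingForestGaugeFixing
open Summit.QuantumFields.BalabanUV.InfraRed.StrongCouplingFrozenForestSpec

namespace Summit.QuantumFields.BalabanUV.InfraRed.StrongCouplingFrozenForestKR

/-! ### §4 `SU(N)`: the frozen Wilson measure is a Gibbs measure of the frozen specification -/

section SUN

variable {d L N : ℕ} [NeZero L]

/-- `exp(−β S_W(U)) = exp(∑_q log v_β(U_q))` for the Wilson plaquette weight of `SU(N)`. [folklore] -/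
theorem exp_neg_mul_wilsonAction_eq_exp_torusLogWeight (β : ℝ)
    (U : GaugeConfig d L (Matrix.specialUnitaryGroup (Fin N) ℂ)) :
    Real.exp (-β * wilsonAction (fundamentalRep (Fin N)) U) = Real.exp (torusLogWeight (wilsonPlaqWeight N β) U) := by
  have hw : groupHeatKernelWeight (d := d) (L := L) (fun _ : ℝ => wilsonPlaqWeight N β) 0 U =
      Real.exp (-β * wilsonAction (fundamentalRep (Fin N)) U) := by
    simp only [groupHeatKernelWeight, wilsonPlaqWeight, wilsonAction, fundamentalRep_apply, neg_mul,
      Finset.mul_sum, Real.exp_sum]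
  rw [← hw, groupHeatKernelWeight_eq_exp_torusLogWeight (wilsonPlaqWeight_pos (N := N) β)]

/-- **The frozen Wilson measure is the frozen Haar measure tilted by the torus log-weight**:
`Z_F⁻¹ e^{−β S_W} d(frozenHaar F) = (frozenHaar F).tilted (∑_q log v_β(U_q))`. [folklore] -/
theorem frozenWilsonMeasure_eq_tilted (F : Finset (Edge d L)) (β : ℝ) :
    frozenWilsonMeasure (d := d) (L := L) (fundamentalRep (Fin N)) F β =
      (frozenHaar (G := Matrix.specialUnitaryGroup (Fin N) ℂ) F).tilted (torusLogWeight (wilsonPlaqWeight N β)) := by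
  set π : Measure (GaugeConfig d L (Matrix.specialUnitaryGroup (Fin N) ℂ)) := frozenHaar F with hπ
  set H : GaugeConfig d L (Matrix.specialUnitaryGroup (Fin N) ℂ) → ℝ := torusLogWeight (wilsonPlaqWeight N β)
    with hH
  have hW : (fun U : GaugeConfig d L (Matrix.specialUnitaryGroup (Fin N) ℂ) =>
      ENNReal.ofReal (Real.exp (-β * wilsonAction (fundamentalRep (Fin N)) U))) =
      fun U => ENNReal.ofReal (Real.exp (H U)) := by
    funext U
    rw [exp_neg_mul_wilsonAction_eq_exp_torusLogWeight]
  have hcont : Continuous fun U : GaugeConfig d L (Matrix.specialUnitaryGroup (Fin N) ℂ) => Real.exp (H U) :=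
    Real.continuous_exp.comp (continuous_torusLogWeight (continuous_wilsonPlaqWeight (N := N) β)
      (wilsonPlaqWeight_pos (N := N) β))
  have hmeas : Measurable fun U : GaugeConfig d L (Matrix.specialUnitaryGroup (Fin N) ℂ) =>
      ENNReal.ofReal (Real.exp (H U)) :=
    ENNReal.measurable_ofReal.comp hcont.measurable
  obtain ⟨C, hC⟩ := isCompact_univ.exists_bound_of_continuousOn hcont.continuousOn
  have hint : Integrable (fun U : GaugeConfig d L (Matrix.specialUnitaryGroup (Fin N) ℂ) => Real.exp (H U)) π :=
    Integrable.of_bound hcont.measurable.aestronglyMeasurable C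
      (Eventually.of_forall fun U => hC U (Set.mem_univ U))
  have hZpos : 0 < ∫ U, Real.exp (H U) ∂π := integral_exp_pos hint
  have huniv : (π.withDensity fun U => ENNReal.ofReal (Real.exp (H U))) Set.univ =
      ENNReal.ofReal (∫ U, Real.exp (H U) ∂π) := by
    rw [withDensity_apply _ MeasurableSet.univ, Measure.restrict_univ,
      ofReal_integral_eq_lintegral_ofReal hint (Eventually.of_forall fun U => (Real.exp_pos _).le)]
  have hdens : (fun U : GaugeConfig d L (Matrix.specialUnitaryGroup (Fin N) ℂ) =>
      ENNReal.ofReal (Real.exp (H U) / ∫ U, Real.exp (H U) ∂π)) =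
      (ENNReal.ofReal (∫ U, Real.exp (H U) ∂π))⁻¹ • fun U => ENNReal.ofReal (Real.exp (H U)) := by
    funext U
    rw [Pi.smul_apply, smul_eq_mul, ENNReal.ofReal_div_of_pos hZpos, div_eq_mul_inv, mul_comm]
  unfold frozenWilsonMeasure frozenWilsonWeight
  rw [← hπ, hW, huniv, Measure.tilted, hdens, withDensity_smul _ hmeas]

/-- **DLR equations of the frozen Wilson measure**: `μ_β^F` is a Gibbs measure of the frozen specification of
`v_β` — for a finite system the DLR equation in the volume `Λ` is the consistency `γ_{edges} γ_Λ = γ_{edges}`.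
[cite: Georgii2011, Def. 1.23 / Rem. 1.24] -/
theorem isGibbsMeasure_frozenWilsonMeasure (F : Finset (Edge d L)) (β : ℝ) :
    IsGibbsMeasure (frozenSpec (d := d) (L := L) F (wilsonPlaqWeight N β))
      (frozenWilsonMeasure (d := d) (L := L) (fundamentalRep (Fin N)) F β) := by
  have hv := continuous_wilsonPlaqWeight (N := N) β
  have hv0 := wilsonPlaqWeight_pos (N := N) β
  have hγ := isSpecification_frozenSpec (d := d) (L := L) F hv hv0
  obtain ⟨η⟩ : Nonempty (GaugeConfig d L (Matrix.specialUnitaryGroup (Fin N) ℂ)) := ⟨fun _ => 1⟩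
  have huniv : frozenSpec (d := d) (L := L) F (wilsonPlaqWeight N β) Finset.univ η =
      frozenWilsonMeasure (d := d) (L := L) (fundamentalRep (Fin N)) F β := by
    rw [frozenSpec_univ, frozenHaar_tilted_freeze, frozenWilsonMeasure_eq_tilted]
  rw [← huniv]
  exact ⟨hγ.isProbability _ _, fun Λ A hA => hγ.consistent (Finset.subset_univ Λ) η A hA⟩

/-! ### §5 `SU(N)`: Dobrushin's condition for the frozen specification, with forest rows -/

/-- **The one-link modulus gives Dobrushin's condition for the FROZEN specification** in Föllmer's
Kantorovich–Rubinstein form, with coefficients `C(e,y) = K (|β|/N) n(e,y)` between dynamic links and `0` as soon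
as `e` or `y` is frozen: a frozen link has the constant law `δ₁`, and a dynamic link sees the boundary condition
only through its frozen version, to which the torus contraction `isKRContraction_torusWilson` applies.
[cite: Follmer1988, Ch. I (2.20)] -/
theorem isKRContraction_frozenWilson (hd : 1 ≤ d) (hN : 1 ≤ N) (hL : 1 < L) (F : Finset (Edge d L))
    {β R K : ℝ} (hK : 0 ≤ K) (hR : |β| / N * (2 * ((d : ℝ) - 1)) ≤ R) (hmod : OneLinkKRModulus N R K) :
    IsKRContraction (frozenSpec (d := d) (L := L) F (wilsonPlaqWeight N β)) suFrobDist linkNbrT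
      fun e y => if e ∈ F ∨ y ∈ F then 0 else K * (|β| / N) * (tInfluence e y : ℝ) := by
  have hv := continuous_wilsonPlaqWeight (N := N) β
  have hT := isKRContraction_torusWilson (d := d) (L := L) hd hN hL hK hR hmod
  refine ⟨not_mem_linkNbrT, fun e y => ?_, fun e η η' h => ?_, fun e y hy ω η hωη φ L' hφm hφb hL' hφL => ?_⟩
  · split_ifs
    · exact le_rfl
    · positivity
  · by_cases he : e ∈ F
    · rw [siteLaw_frozenSpec_of_mem F hv he, siteLaw_frozenSpec_of_mem F hv he]
    · rw [siteLaw_frozenSpec_of_not_mem F hv he, siteLaw_frozenSpec_of_not_mem F hv he]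
      refine hT.siteLaw_congr e _ _ fun z hz => ?_
      by_cases hzF : z ∈ F
      · rw [freezeConfig_of_mem F hzF, freezeConfig_of_mem F hzF]
      · rw [freezeConfig_of_not_mem F hzF, freezeConfig_of_not_mem F hzF]
        exact h z hz
  · by_cases he : e ∈ F
    · rw [if_pos (Or.inl he), siteLaw_frozenSpec_of_mem F hv he ω, siteLaw_frozenSpec_of_mem F hv he η, sub_self,
        abs_zero, zero_mul, zero_mul]
    · by_cases hyF : y ∈ F
      · have hfr : freezeConfig F ω = freezeConfig F η :=
          freezeConfig_congr F fun z hz => hωη z fun hzy => hz (hzy ▸ hyF)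
        rw [if_pos (Or.inr hyF), siteLaw_frozenSpec_of_not_mem F hv he, siteLaw_frozenSpec_of_not_mem F hv he,
          hfr, sub_self, abs_zero, zero_mul, zero_mul]
      · rw [if_neg (not_or.2 ⟨he, hyF⟩), siteLaw_frozenSpec_of_not_mem F hv he,
          siteLaw_frozenSpec_of_not_mem F hv he]
        have hagree : ∀ z, z ≠ y → freezeConfig F ω z = freezeConfig F η z := by
          intro z hz
          by_cases hzF : z ∈ F
          · rw [freezeConfig_of_mem F hzF, freezeConfig_of_mem F hzF]
          · rw [freezeConfig_of_not_mem F hzF, freezeConfig_of_not_mem F hzF]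
            exact hωη z hz
        have h := hT.contract e y hy (freezeConfig F ω) (freezeConfig F η) hagree φ L' hφm hφb hL' hφL
        rwa [freezeConfig_of_not_mem F hyF, freezeConfig_of_not_mem F hyF] at h

/-- **Row sums of the frozen Dobrushin coefficients are the forest rows**:
`∑_{y ∈ nbr e} C(e,y) = K (|β|/N) · forestRow F e` at a dynamic link and `0` at a frozen one. [folklore] -/
theorem sum_linkNbrT_frozenCoeff_eq (F : Finset (Edge d L)) (β K : ℝ) (e : Edge d L) :
    (∑ y ∈ linkNbrT e, if e ∈ F ∨ y ∈ F then (0 : ℝ) else K * (|β| / N) * (tInfluence e y : ℝ)) =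
      if e ∈ F then 0 else K * (|β| / N) * (forestRow F e : ℝ) := by
  by_cases he : e ∈ F
  · simp [he]
  · simp only [he, false_or, if_false, forestRow, Nat.cast_sum, Nat.cast_ite, Nat.cast_zero, Finset.mul_sum]
    refine Finset.sum_congr rfl fun y _ => ?_
    split_ifs <;> simp

/-- **The forest-reduced Dobrushin constant**: under `ForestRowBound F D` every row sum of the frozen coefficients
is at most `D (|β|/N) K` (`D = 18` without a forest, `sum_linkNbrT_wilsonCoeff_le`). [folklore] -/
theorem sum_linkNbrT_frozenCoeff_le (F : Finset (Edge d L)) {D : ℕ} (hD : ForestRowBound F D) {β K : ℝ}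
    (hK : 0 ≤ K) (e : Edge d L) :
    (∑ y ∈ linkNbrT e, if e ∈ F ∨ y ∈ F then (0 : ℝ) else K * (|β| / N) * (tInfluence e y : ℝ)) ≤
      (D : ℝ) * (|β| / N) * K := by
  rw [sum_linkNbrT_frozenCoeff_eq]
  split_ifs with he
  · positivity
  · have h := hD e he
    calc K * (|β| / N) * (forestRow F e : ℝ) ≤ K * (|β| / N) * D :=
          mul_le_mul_of_nonneg_left (by exact_mod_cast h) (by positivity)
      _ = (D : ℝ) * (|β| / N) * K := by ring

end SUN

/-! ### §6 Smoothing by the frozen specification: locality and Lipschitz bounds -/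

section FrozenSmoothing

variable {d L : ℕ} [NeZero L] {G : Type*} [Group G] [TopologicalSpace G] [IsTopologicalGroup G]
  [CompactSpace G] [MeasurableSpace G] [BorelSpace G] [SecondCountableTopology G]

variable (F : Finset (Edge d L))

omit [TopologicalSpace G] [IsTopologicalGroup G] [CompactSpace G] [MeasurableSpace G] [BorelSpace G]
  [SecondCountableTopology G] [NeZero L] in
/-- Freezing a glued configuration: freeze the inside datum on `F ∩ Λ` and the outside configuration. [folklore] -/
theorem freezeConfig_glueWith (Λ : Finset (Edge d L)) (ζ : ↥Λ → G) (σ : GaugeConfig d L G) :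
    freezeConfig F (glueWith Λ ζ σ) =
      glueWith Λ (fun z => if (z : Edge d L) ∈ F then 1 else ζ z) (freezeConfig F σ) := by
  funext z
  by_cases hzΛ : z ∈ Λ <;> by_cases hzF : z ∈ F <;> simp [freezeConfig, glueWith, hzΛ, hzF]

/-- **The frozen smoothing as a tilted product integral**: `γ^F_Λ f (η) = ∫ f(ζ η_{Λᶜ}) μ_η(dζ)` with
`μ_η = (⊗_{e ∈ Λ} ν_e).tilted (W ∘ freeze_F ∘ (ζ ↦ ζ η_{Λᶜ}))`. [cite: Georgii2011, Def. 2.9] -/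
theorem specAvg_frozenSpec_eq {v : G → ℝ} (hv : Continuous v) (Λ : Finset (Edge d L))
    {f : GaugeConfig d L G → ℝ} (hfm : Measurable f) (η : GaugeConfig d L G) :
    specAvg (frozenSpec F v) Λ f η =
      ∫ ζ, f (glueWith Λ ζ η) ∂((Measure.pi fun e : ↥Λ => frozenRef (G := G) F (e : Edge d L)).tilted
        fun ζ => torusLogWeight v (freezeConfig F (glueWith Λ ζ η))) := by
  unfold specAvg frozenSpec
  rw [← map_tilted_comp _ (measurable_glueWith Λ η)
      ((measurable_torusLogWeight hv).comp (measurable_freezeConfig F)),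
    integral_map (measurable_glueWith Λ η).aemeasurable hfm.aestronglyMeasurable]
  rfl

/-- **The frozen smoothing of an observable measurable inside `Λ` depends only on the plaquette closure of `Λ`.**
[folklore] -/
theorem dependsOn_specAvg_frozenSpec {v : G → ℝ} (hv : Continuous v) (Λ : Finset (Edge d L))
    {f : GaugeConfig d L G → ℝ} (hfm : Measurable f) (hfdep : DependsOn f (↑Λ : Set (Edge d L))) :
    DependsOn (specAvg (frozenSpec F v) Λ f) (↑(plaqClosure Λ) : Set (Edge d L)) := by
  intro σ τ h
  obtain ⟨κ, hκ⟩ := exists_torusLogWeight_glueWith_eq_add v Λ (σ := freezeConfig F σ) (τ := freezeConfig F τ)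
    fun z hz => by
      by_cases hzF : z ∈ F
      · rw [freezeConfig_of_mem F hzF, freezeConfig_of_mem F hzF]
      · rw [freezeConfig_of_not_mem F hzF, freezeConfig_of_not_mem F hzF]
        exact h z hz
  rw [specAvg_frozenSpec_eq F hv Λ hfm σ, specAvg_frozenSpec_eq F hv Λ hfm τ]
  have hint : ∀ ζ : ↥Λ → G, f (glueWith Λ ζ σ) = f (glueWith Λ ζ τ) := fun ζ => hfdep fun z hz => by
    rw [glueWith_apply_mem _ _ _ hz, glueWith_apply_mem _ _ _ hz]
  have hW : ∀ ζ : ↥Λ → G, torusLogWeight v (freezeConfig F (glueWith Λ ζ σ)) =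
      κ + torusLogWeight v (freezeConfig F (glueWith Λ ζ τ)) := fun ζ => by
    rw [freezeConfig_glueWith, freezeConfig_glueWith, hκ]
  simp_rw [hint, hW]
  rw [tilted_const_add_eq]

omit [TopologicalSpace G] [IsTopologicalGroup G] [CompactSpace G] [MeasurableSpace G] [BorelSpace G]
  [SecondCountableTopology G] in
/-- **One-link Lipschitz bound for the frozen glued energy**: as `abs_torusLogWeight_glueWith_sub_le`, with the energy
read on the frozen configuration (a frozen link `y` does not move the energy at all). [folklore] -/
theorem abs_torusLogWeight_freeze_glueWith_sub_le {v : G → ℝ} {r : G → G → ℝ} {ℓ : ℝ} (hℓ : 0 ≤ ℓ)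
    (hr : ∀ a b, 0 ≤ r a b)
    (hvLip : ∀ (q : Plaquette d L) (y : Edge d L), y ∈ plaqEdgesT q → ∀ U U' : GaugeConfig d L G,
      (∀ z, z ≠ y → U z = U' z) →
      |Real.log (v (plaquetteHolonomy U q.1 q.2.1.1 q.2.1.2)) -
          Real.log (v (plaquetteHolonomy U' q.1 q.2.1.1 q.2.1.2))| ≤ ℓ * r (U y) (U' y))
    (Λ : Finset (Edge d L)) {y : Edge d L} (hy : y ∉ Λ) {σ τ : GaugeConfig d L G}
    (hστ : ∀ z, z ≠ y → σ z = τ z) (ζ : ↥Λ → G) :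
    |torusLogWeight v (freezeConfig F (glueWith Λ ζ σ)) - torusLogWeight v (freezeConfig F (glueWith Λ ζ τ))| ≤
      ((2 * (d - 1) : ℕ) : ℝ) * (ℓ * r (σ y) (τ y)) := by
  rw [freezeConfig_glueWith, freezeConfig_glueWith]
  have hστ' : ∀ z, z ≠ y → freezeConfig F σ z = freezeConfig F τ z := fun z hz => by
    by_cases hzF : z ∈ F
    · rw [freezeConfig_of_mem F hzF, freezeConfig_of_mem F hzF]
    · rw [freezeConfig_of_not_mem F hzF, freezeConfig_of_not_mem F hzF]
      exact hστ z hz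
  by_cases hyF : y ∈ F
  · have heq : freezeConfig F σ = freezeConfig F τ :=
      freezeConfig_congr F fun z hz => hστ z fun hzy => hz (hzy ▸ hyF)
    rw [heq, sub_self, abs_zero]
    exact mul_nonneg (Nat.cast_nonneg _) (mul_nonneg hℓ (hr _ _))
  · have h := abs_torusLogWeight_glueWith_sub_le hℓ hr hvLip Λ hy hστ'
      (fun z => if (z : Edge d L) ∈ F then 1 else ζ z)
    rwa [freezeConfig_of_not_mem F hyF, freezeConfig_of_not_mem F hyF] at h

/-- **The frozen smoothing is Lipschitz in every outside link** (Georgii 2011, Prop. 8.8, metric form, for the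
frozen specification): same constant `M (e^{4(d−1)ℓD} − 1)/D` as `isLipBound_specAvg_torusWeightSpec`.
[cite: Georgii2011, Prop. 8.8] -/
theorem isLipBound_specAvg_frozenSpec {v : G → ℝ} (hv : Continuous v) (hv0 : ∀ g, 0 < v g)
    {r : G → G → ℝ} (hr0 : ∀ a b, 0 ≤ r a b) {D : ℝ} (hD : 0 < D) (hrD : ∀ a b, r a b ≤ D) {ℓ : ℝ} (hℓ : 0 ≤ ℓ)
    (hvLip : ∀ (q : Plaquette d L) (y : Edge d L), y ∈ plaqEdgesT q → ∀ U U' : GaugeConfig d L G,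
      (∀ z, z ≠ y → U z = U' z) →
      |Real.log (v (plaquetteHolonomy U q.1 q.2.1.1 q.2.1.2)) -
          Real.log (v (plaquetteHolonomy U' q.1 q.2.1.1 q.2.1.2))| ≤ ℓ * r (U y) (U' y))
    (Λ : Finset (Edge d L)) {f : GaugeConfig d L G → ℝ} (hfm : Measurable f)
    (hfdep : DependsOn f (↑Λ : Set (Edge d L))) {M : ℝ} (hM : ∀ σ, |f σ| ≤ M) :
    IsLipBound r (specAvg (frozenSpec F v) Λ f)
      fun _ => M * ((Real.exp (D * (2 * (((2 * (d - 1) : ℕ) : ℝ) * ℓ))) - 1) / D) := by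
  have hM0 : 0 ≤ M := (abs_nonneg _).trans (hM fun _ => 1)
  set a : ℝ := 2 * (((2 * (d - 1) : ℕ) : ℝ) * ℓ) with ha
  have ha0 : 0 ≤ a := by positivity
  have hE0 : 0 ≤ (Real.exp (D * a) - 1) / D :=
    div_nonneg (sub_nonneg.2 (Real.one_le_exp (by positivity))) hD.le
  refine ⟨fun _ => mul_nonneg hM0 hE0, fun y σ τ hστ => ?_⟩
  by_cases hy : y ∈ Λ
  · have hglue : ∀ ζ : ↥Λ → G, glueWith Λ ζ σ = glueWith Λ ζ τ := fun ζ => funext fun z => by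
      by_cases hzΛ : z ∈ Λ
      · rw [glueWith_apply_mem _ _ _ hzΛ, glueWith_apply_mem _ _ _ hzΛ]
      · rw [glueWith_apply_not_mem _ _ _ hzΛ, glueWith_apply_not_mem _ _ _ hzΛ,
          hστ z (by rintro rfl; exact hzΛ hy)]
    rw [specAvg_frozenSpec_eq F hv Λ hfm σ, specAvg_frozenSpec_eq F hv Λ hfm τ]
    simp_rw [hglue]
    rw [sub_self, abs_zero]
    exact mul_nonneg (mul_nonneg hM0 hE0) (hr0 _ _)
  · rw [specAvg_frozenSpec_eq F hv Λ hfm σ, specAvg_frozenSpec_eq F hv Λ hfm τ]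
    have hint : ∀ ζ : ↥Λ → G, f (glueWith Λ ζ τ) = f (glueWith Λ ζ σ) := fun ζ => hfdep fun z hz => by
      rw [glueWith_apply_mem _ _ _ hz, glueWith_apply_mem _ _ _ hz]
    simp_rw [hint]
    have hWm : Measurable (torusLogWeight (d := d) (L := L) v ∘ freezeConfig F) :=
      (measurable_torusLogWeight hv).comp (measurable_freezeConfig F)
    have h1m : Measurable fun ζ : ↥Λ → G => torusLogWeight v (freezeConfig F (glueWith Λ ζ σ)) :=
      hWm.comp (measurable_glueWith Λ σ)
    have h2m : Measurable fun ζ : ↥Λ → G => torusLogWeight v (freezeConfig F (glueWith Λ ζ τ)) :=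
      hWm.comp (measurable_glueWith Λ τ)
    obtain ⟨B, hB⟩ := exists_abs_torusLogWeight_le (d := d) (L := L) hv hv0
    have hφm : Measurable fun ζ : ↥Λ → G => f (glueWith Λ ζ σ) := hfm.comp (measurable_glueWith Λ σ)
    have hφL : ∀ a' b' : ↥Λ → G, |f (glueWith Λ a' σ) - f (glueWith Λ b' σ)| ≤ 2 * M := fun a' b' =>
      calc |f (glueWith Λ a' σ) - f (glueWith Λ b' σ)| ≤ |f (glueWith Λ a' σ)| + |f (glueWith Λ b' σ)| := abs_sub _ _
        _ ≤ M + M := add_le_add (hM _) (hM _)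
        _ = 2 * M := by ring
    have key := abs_integral_tilted_sub_integral_tilted_le
      (Measure.pi fun e : ↥Λ => frozenRef (G := G) F (e : Edge d L)) h1m h2m
      ⟨B, fun ζ => hB _⟩ ⟨B, fun ζ => hB _⟩ (κ := 0) (ε := ((2 * (d - 1) : ℕ) : ℝ) * (ℓ * r (σ y) (τ y)))
      (fun ζ => by rw [sub_zero]; exact abs_torusLogWeight_freeze_glueWith_sub_le F hℓ hr0 hvLip Λ hy hστ ζ) hφm
      ⟨M, fun ζ => hM _⟩ hφL
    refine key.trans ?_
    have hconv := exp_mul_sub_one_le_div_mul (k := r (σ y) (τ y)) (K := D) (t := a) (hr0 _ _) (hrD _ _) hD ha0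
    have e1 : 2 * (((2 * (d - 1) : ℕ) : ℝ) * (ℓ * r (σ y) (τ y))) = r (σ y) (τ y) * a := by rw [ha]; ring
    rw [e1]
    calc (Real.exp (r (σ y) (τ y) * a) - 1) / 2 * (2 * M) = M * (Real.exp (r (σ y) (τ y) * a) - 1) := by ring
      _ ≤ M * (r (σ y) (τ y) / D * (Real.exp (D * a) - 1)) := mul_le_mul_of_nonneg_left hconv hM0
      _ = M * ((Real.exp (D * a) - 1) / D) * r (σ y) (τ y) := by ring

end FrozenSmoothing

end Summit.QuantumFields.BalabanUV.InfraRed.StrongCouplingFrozenForestKR
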